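import Literature.Geometry.Lorentzian.HypersurfaceShadowDomainCauchy
import Literature.Geometry.Lorentzian.CauchyDevelopmentCausal
import Literature.Geometry.Lorentzian.CauchyDevelopment
import HarnessLib

/-!
# Crux `CaptureSufficesC2` (stmt-FinalStateConjecture-14986), line `Sketch` — stub
# `stub_hypersurfaceMGHDRealised` (S2), part 3: the SHADOW DOMAIN of an acausal data hypersurface
# of a vacuum Cauchy development

For a vacuum Cauchy development `𝓜` and a smooth embedding `j : N → 𝓜` with future unit normal
`ν` inducing data `D'` on `N` (so that `(𝓜, j, ν)` is a data embedding of `D'`) with ACAUSAL image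
`S = j(N)`, the shadow domain `W = S ∪ W⁺ ∪ W⁻` of `S` (`Literature/…/HypersurfaceShadowDomain.lean`,
`W± = ⋃ {I∓(x) ∩ I±(S) : j⁻¹ J∓(x) compact}`) is an open connected region containing `S` in which
`S` is a Cauchy hypersurface and which contains every point of `I±(S)` whose shadow on `S` lies
in a compact subset of `S` — the hypotheses (hDsh±) of the shadow form of "no corresponding
boundary points" (`Literature/…/HypersurfaceCorrespondingBoundaryShadow.lean`). This is the
region through which the MGHD of the hypersurface datum is glued into `𝓜` (part 4,
`…StubHypersurfaceMGHDRealisedCBG.lean`); it replaces the Cauchy development `D(S)` of the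
printed proofs (Hawking–Ellis 1973, §7.6; O'Neill 1983, Def. 14.35, Lemma 14.43), whose openness
in the tree's curve class would need limit-curve arguments.

The displayed inputs of the Literature theorems are discharged for Cauchy developments: local
trichotomy at `S` (`DataEmbedding.exists_nhds_subset_trichotomy`, Gaussian normal coordinates),
closedness of `≤`, compactness of `J±(C) ∩ J∓(y)`, non-imprisonment, the causality condition
(`CauchyDevelopmentGlobalHyperbolicityProofs`, `HypersurfaceCorrespondingBoundary`,
`CauchyDevelopmentCausal`). Registered sub-goal: `stub_hypersurfaceMGHDRealised_shadowRegion`.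
No definitions, no named facts.
-/

noncomputable section

set_option linter.dupNamespace false

open Function Set Filter Topology TopologicalSpace Bundle
open scoped Manifold ContDiff Topology

namespace Summit.FinalStateConjecture.FinalStateConjecture.Theorems.CaptureSufficesC2.Sketch

open Literature.Geometry.Lorentzian

namespace HypersurfaceMGHDRealised

/-- **The shadow domain of an acausal data hypersurface of a vacuum Cauchy development**: an open
connected `W ⊇ j(N)` in which `j(N)` is a Cauchy hypersurface and which contains every
`q ∈ I⁺(j N)` (resp. `I⁻(j N)`) whose shadow `I⁻(q) ∩ j(N)` (resp. `I⁺(q) ∩ j(N)`) lies in a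
compact subset of `j(N)`. `W` is the shadow domain of `Literature/…/HypersurfaceShadowDomain.lean`
for `ι = j`, whose displayed inputs hold in a Cauchy development (global hyperbolicity, causality)
and for the image of the data embedding `(𝓜, j, ν)` (local trichotomy in Gaussian normal
coordinates). [cite: ONeillSemiRiemannian1983, Ch. 14, Def. 14.35, Thm. 14.38 and Lemma 14.43]
[cite: HawkingEllis1973CUP, §6.6, Prop. 6.6.3 and §7.6, p. 250] -/
theorem exists_shadowRegion
    {X : Type} [TopologicalSpace X] [ChartedSpace E3 X] [IsManifold (𝓡 3) ∞ X] [ConnectedSpace X]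
    {D : InitialDataSet (𝓡 3) X} (𝓜 : VacuumCauchyDevelopment D)
    {N : Type} [TopologicalSpace N] [ChartedSpace E3 N] [IsManifold (𝓡 3) ∞ N] [ConnectedSpace N]
    {D' : InitialDataSet (𝓡 3) N} {j : N → 𝓜.carrier} {ν : NormalField (𝓡 4) j}
    (hj : Manifold.IsSmoothEmbedding (𝓡 3) (𝓡 4) ∞ j)
    (hν : 𝓜.metric.IsFutureUnitNormal (𝓡 3) 𝓜.timeOrientation j ν)
    (hh : ∀ y : N, pullbackBilin (I := 𝓡 4) (I' := 𝓡 3) j 𝓜.metric.val y = D'.h.inner y)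
    (hk : ∀ [𝓜.metric.toPseudoRiemannianMetric.HasLeviCivita] (y : N),
      𝓜.metric.toPseudoRiemannianMetric.secondFundamentalForm (𝓡 3) j ν y = D'.kBilin y)
    (hac : ∀ p ∈ Set.range j, ∀ q ∈ Set.range j,
      q ∈ 𝓜.metric.causalFuture 𝓜.timeOrientation {p} → q = p) :
    ∃ W : Opens 𝓜.carrier, Set.range j ⊆ W ∧ IsConnected (W : Set 𝓜.carrier) ∧
      (𝓜.metric.restrict PseudoRiemannianMetric.contMDiff_restrict_holds W).IsCauchyHypersurface
        (𝓜.timeOrientation.restrict PseudoRiemannianMetric.contMDiff_restrict_holds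
          𝓜.timeOrientation.contMDiff_restrict_holds W) (Subtype.val ⁻¹' Set.range j) ∧
      (∀ q ∈ 𝓜.metric.chronologicalFuture 𝓜.timeOrientation (Set.range j),
        (∃ C : Set 𝓜.carrier, C ⊆ Set.range j ∧ IsCompact C ∧
          𝓜.metric.chronologicalPast 𝓜.timeOrientation {q} ∩ Set.range j ⊆ C) → q ∈ W) ∧
      (∀ q ∈ 𝓜.metric.chronologicalPast 𝓜.timeOrientation (Set.range j),
        (∃ C : Set 𝓜.carrier, C ⊆ Set.range j ∧ IsCompact C ∧
          𝓜.metric.chronologicalFuture 𝓜.timeOrientation {q} ∩ Set.range j ⊆ C) → q ∈ W) := by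
  classical
  -- instances
  haveI : T2Space N := hj.isEmbedding.t2Space
  haveI : LocallyCompactSpace N := ChartedSpace.locallyCompactSpace (EuclideanSpace ℝ (Fin 3)) N
  haveI : 𝓜.metric.HasLeviCivita := 𝓜.metric.toPseudoRiemannianMetric.hasLeviCivita
  haveI : CovariantDerivative.ContMDiffCovariantDerivative 𝓜.metric.leviCivita 1 :=
    ⟨𝓜.metric.isLocallyContMDiff_leviCivita_holds 1 (by exact_mod_cast le_top) univ isOpen_univ⟩
  have hn2 : (2 : ℕ∞ω) ≤ ∞ := WithTop.coe_le_coe.mpr le_top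
  -- the data embedding `(𝓜, j, ν)` of `D'` and the local trichotomy at `j(N)`
  let 𝒮 : DataEmbedding D' :=
    { toSpacetime := 𝓜.toSpacetime
      embed := j
      isSmoothEmbedding := hj
      normal := ν
      isFutureUnitNormal := hν
      induced_h := hh
      induced_k := hk }
  have hLT : ∀ (u : N) (O : Set N), IsOpen O → u ∈ O → ∃ B : Set 𝓜.carrier, IsOpen B ∧ j u ∈ B ∧
      B ⊆ j '' O ∪ 𝓜.metric.chronologicalFuture 𝓜.timeOrientation (j '' O) ∪
        𝓜.metric.chronologicalPast 𝓜.timeOrientation (j '' O) :=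
    fun u O hO huO ↦ 𝒮.exists_nhds_subset_trichotomy u hO huO
  have hLT' : ∀ u : N, ∃ B : Set 𝓜.carrier, IsOpen B ∧ j u ∈ B ∧
      B ⊆ range j ∪ 𝓜.metric.chronologicalFuture 𝓜.timeOrientation (range j) ∪
        𝓜.metric.chronologicalPast 𝓜.timeOrientation (range j) :=
    fun u ↦ 𝒮.exists_nhds_subset_trichotomy_range u
  -- global hyperbolicity and causality of `𝓜` in the forms used
  have hcwb := 𝓜.toCauchyDevelopment.isCausallyWellBehaved
  have hrel : ∀ {xs ys : ℕ → 𝓜.carrier} {x y : 𝓜.carrier}, Tendsto xs atTop (𝓝 x) →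
      Tendsto ys atTop (𝓝 y) → (∀ k, ys k ∈ 𝓜.metric.causalFuture 𝓜.timeOrientation {xs k}) →
      y ∈ 𝓜.metric.causalFuture 𝓜.timeOrientation {x} :=
    fun hx hy hxy ↦ 𝓜.toCauchyDevelopment.mem_causalFuture_of_tendsto hx hy hxy
  have hKC : ∀ C : Set 𝓜.carrier, IsCompact C → ∀ y : 𝓜.carrier,
      IsCompact (𝓜.metric.causalFuture 𝓜.timeOrientation C ∩
        𝓜.metric.causalPast 𝓜.timeOrientation {y}) :=
    fun C hC y ↦ 𝓜.toCauchyDevelopment.isCompact_causalFuture_inter_causalPast_of_isCompact hC y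
  have hKC' : ∀ C : Set 𝓜.carrier, IsCompact C → ∀ y : 𝓜.carrier,
      IsCompact (𝓜.metric.causalPast 𝓜.timeOrientation C ∩
        𝓜.metric.causalFuture 𝓜.timeOrientation {y}) :=
    fun C hC y ↦ 𝓜.toCauchyDevelopment.isCompact_causalPast_inter_causalFuture_of_isCompact hC y
  have himp : ∀ K : Set 𝓜.carrier, IsCompact K → ∀ (γ : ℝ → 𝓜.carrier) (s : Set ℝ),
      s.OrdConnected → 𝓜.metric.IsFutureCausalCurveOn 𝓜.timeOrientation γ s → IsPastEndless γ s →
      ∀ t₀ ∈ s, ∃ t ∈ s, t ≤ t₀ ∧ γ t ∉ K :=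
    fun K hK γ s hs hγ hend t₀ ht₀ ↦
      𝓜.toCauchyDevelopment.exists_le_notMem_of_isPastEndless hK hs hγ hend ht₀
  have himp' : ∀ K : Set 𝓜.carrier, IsCompact K → ∀ (γ : ℝ → 𝓜.carrier) (s : Set ℝ),
      s.OrdConnected → 𝓜.metric.IsFutureCausalCurveOn 𝓜.timeOrientation γ s → IsFutureEndless γ s →
      ∀ t₀ ∈ s, ∃ t ∈ s, t₀ ≤ t ∧ γ t ∉ K :=
    fun K hK γ s hs hγ hend t₀ ht₀ ↦
      𝓜.toCauchyDevelopment.exists_ge_notMem_of_isFutureEndless hK hs hγ hend ht₀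
  have hιe : IsEmbedding j := hj.isEmbedding
  -- the shadow domain `V = S ∪ V⁺ ∪ V⁻`
  set Vp : Set 𝓜.carrier := {y | y ∈ 𝓜.metric.chronologicalFuture 𝓜.timeOrientation (range j) ∧
    ∃ x ∈ 𝓜.metric.chronologicalFuture 𝓜.timeOrientation {y},
      ∃ K : Set N, IsCompact K ∧ j ⁻¹' 𝓜.metric.causalPast 𝓜.timeOrientation {x} ⊆ K} with hVp
  set Vm : Set 𝓜.carrier := {y | y ∈ 𝓜.metric.chronologicalPast 𝓜.timeOrientation (range j) ∧
    ∃ x ∈ 𝓜.metric.chronologicalPast 𝓜.timeOrientation {y},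
      ∃ K : Set N, IsCompact K ∧ j ⁻¹' 𝓜.metric.causalFuture 𝓜.timeOrientation {x} ⊆ K} with hVm
  have hVo : IsOpen (range j ∪ Vp ∪ Vm) :=
    LorentzianMetric.isOpen_shadowDomain hn2 hcwb hιe.continuous hιe.injective hac hLT hrel hKC
      hKC' hVp hVm
  refine ⟨⟨range j ∪ Vp ∪ Vm, hVo⟩, subset_union_left.trans subset_union_left,
    LorentzianMetric.isConnected_shadowDomain hn2 hιe.continuous hVp hVm,
    LorentzianMetric.isCauchyHypersurface_shadowDomain le_rfl
      PseudoRiemannianMetric.contMDiff_restrict_holds 𝓜.timeOrientation.contMDiff_restrict_holds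
      hcwb hιe.continuous hac hLT' hrel hKC hKC' himp himp' hVp hVm hVo,
    fun q hq hC ↦ ?_, fun q hq hC ↦ ?_⟩
  · obtain ⟨C, hCS, hCc, hsh⟩ := hC
    exact Or.inl (Or.inr (LorentzianMetric.mem_shadowDomain_of_shadow_subset hn2 hcwb hιe hac hLT
      hrel hKC hVp hq hCS hCc hsh))
  · obtain ⟨C, hCS, hCc, hsh⟩ := hC
    exact Or.inr (LorentzianMetric.mem_shadowDomain_of_shadow_subset' hn2 hcwb hιe hac hLT hrel hKC'
      hVm hq hCS hCc hsh)

end HypersurfaceMGHDRealised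

open HypersurfaceMGHDRealised

/-- **Registered sub-goal `stub_hypersurfaceMGHDRealised_shadowRegion`** (the shadow domain of
an acausal data hypersurface of a vacuum Cauchy development; one line over
`HypersurfaceMGHDRealised.exists_shadowRegion`).
[cite: ONeillSemiRiemannian1983, Ch. 14, Def. 14.35, Thm. 14.38 and Lemma 14.43] -/
theorem stub_hypersurfaceMGHDRealised_shadowRegion : ∀ (X : Type) [TopologicalSpace X] [ChartedSpace E3 X] [IsManifold (𝓡 3) ∞ X] [ConnectedSpace X] (D : InitialDataSet (𝓡 3) X) (𝓜 : VacuumCauchyDevelopment D) (N : Type) [TopologicalSpace N] [ChartedSpace E3 N] [IsManifold (𝓡 3) ∞ N] [ConnectedSpace N] (D' : InitialDataSet (𝓡 3) N) (j : N → 𝓜.carrier) (ν : NormalField (𝓡 4) j), Manifold.IsSmoothEmbedding (𝓡 3) (𝓡 4) ∞ j → 𝓜.metric.IsFutureUnitNormal (𝓡 3) 𝓜.timeOrientation j ν → (∀ y : N, pullbackBilin (I := 𝓡 4) (I' := 𝓡 3) j 𝓜.metric.val y = D'.h.inner y) → (∀ [𝓜.metric.toPseudoRiemannianMetric.HasLeviCivita]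 (y : N), 𝓜.metric.toPseudoRiemannianMetric.secondFundamentalForm (𝓡 3) j ν y = D'.kBilin y) → (∀ p ∈ Set.range j, ∀ q ∈ Set.range j, q ∈ 𝓜.metric.causalFuture 𝓜.timeOrientation {p} → q = p) → ∃ W : TopologicalSpace.Opens 𝓜.carrier, Set.range j ⊆ W ∧ IsConnected (W : Set 𝓜.carrier) ∧ (𝓜.metric.restrict PseudoRiemannianMetric.contMDiff_restrict_holds W).IsCauchyHypersurface (𝓜.timeOrientation.restrict PseudoRiemannianMetric.contMDiff_restrict_holds 𝓜.timeOrientation.contMDiff_restrict_holds W) (Subtype.val ⁻¹' Set.range j) ∧ (∀ q ∈ 𝓜.metric.chronologicalFuture 𝓜.timeOrientation (Set.range j), (∃ C : Set 𝓜.carrier, C ⊆ Set.range j ∧ IsCompact C ∧ 𝓜.metric.chronologicalPast 𝓜.timeOrientation {q} ∩ Set.range j ⊆ C) → q ∈ W) ∧ (∀ q ∈ 𝓜.metric.chronologicalPast 𝓜.timeOrientation (Set.range j), (∃ C : Set 𝓜.carrier, C ⊆ Set.range j ∧ IsCompact C ∧ 𝓜.metric.chronologicalFuture 𝓜.timeOrientation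 {q} ∩ Set.range j ⊆ C) → q ∈ W) :=
  fun _ _ _ _ _ _ 𝓜 _ _ _ _ _ _ _ _ hj hν hh hk hac ↦ exists_shadowRegion 𝓜 hj hν hh hk hac

end Summit.FinalStateConjecture.FinalStateConjecture.Theorems.CaptureSufficesC2.Sketch

end
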